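import Summits.AtomisticToContinuum.FouriersLaw.Theorems.BondHeatUncertaintyBoundedResponseStorageLeak
import Summits.AtomisticToContinuum.FouriersLaw.Theorems.BondHeatUncertaintyBoundedResponseEnergyFluctuation
import Summits.AtomisticToContinuum.FouriersLaw.Theorems.GriffithsLimitExchangeKernelIntegrable
import Summits.AtomisticToContinuum.FouriersLaw.Theorems.GriffithsLimitExchangeSandwichGlue
import Summits.AtomisticToContinuum.FouriersLaw.Theorems.OddSectorIrreversibilityWitnessGlueReflection
import Summits.AtomisticToContinuum.FouriersLaw.Theorems.JunctionLocalityNonBallisticProfileUniformBound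
import HarnessLib

/-!
# `BondHeatUncertainty.BoundedResponse` (11071) — NODE g96 «SurvivalSumRule» (lens-1, cell decomp-a2c)

**The survival sum rule and its consequences.**  For the pinned anharmonic chain with two Langevin contacts at the
same temperature `T` (`μ_T` its Gibbs measure, `P_t` its semigroup, `θ_b = p_b² − T`, `h_b = ∫₀^∞ P_t θ_b dt` the contact
Kubo correctors, `K_N(u) = ⟨θ₀, P_u θ₀⟩`, `K̃_N(u) = ⟨θ₀, P_u θ_{N−1}⟩` the near / far (escape / cross) kernels) put

* `S_N(t) := (γ/T²) ∫_{(t,∞)} (K_N + K̃_N)` — the **two-exit survival function** (`survival`): literally the `S` of the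
  `GriffithsLimitExchange` crux `VanishingSurvival` (13200).  For `N ≥ 2`, `t ≥ 0`:
  `S_N(t) = 1 − θ_N(t) − φ_N(t)` (`survival_eq`; `θ_N(t) = (γ/T²)∫₀ᵗ K_N` the near step response, `φ_N(t) = (γ/T²)∫₀ᵗ K̃_N`
  the far one), by the **exit identity** `(γ/T²)(∫_{(0,∞)} K_N + ∫_{(0,∞)} K̃_N) = 1` (`escapeDeficit_eq_integral_crossKernel`:
  `E_N = (γ/T²)∫_{(0,∞)} K̃_N`, the end-to-end transmission).

**Theorem (first law, `storageResponse_eq_integral_survival`).** `S^{stor}_N(t) = ∫₀ᵗ S_N(s) ds` (`N ≥ 2`, `t ≥ 0`), where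
`S^{stor}_N` is the storage response of `…StorageLeakA` (`W_N = S^{stor}_N + F_N`).

**Theorem (sum rule, `tendsto_storageResponse` + `energyPairing_eq_half_variance`).**
`S^{stor}_N(t) → Λ_N/T²` as `t → ∞`, `Λ_N := ⟨H − ⟨H⟩, h₀⟩_{μ_T} = Var_T(H_N)/(2γ)`; hence, whenever `K_N + K̃_N ≥ 0` on `[0,∞)`,
`∫₀^∞ S_N(t) dt = Var_T(H_N)/(2γT²)` (`survival_sum_rule`) and `t·S_N(t) ≤ S^{stor}_N(t) ≤ Var_T(H_N)/(2γT²)` for every `t ≥ 0`.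
Ingredients: the flip–Fubini identity over `(0,∞)` (`integral_flip_mul_kinCorrector_eq`, detailed balance), the exponential
decay of centred cross-correlations (tree, `LoomisCompactHorizonWitness`), the pair identity `h₀ + h_{N−1} = (H − ⟨H⟩)/γ` a.e.
(tree, `kinCorrector_pair_ae_eq`) and the **left–right reflection symmetry** `⟨H − ⟨H⟩, h₀⟩ = ⟨H − ⟨H⟩, h_{N−1}⟩`
(`energyPairing_zero_eq_last`, from `transitionKernel_siteReflection` and the reflection invariance of `μ_T`).

**Consequences (all with the tree's (V) `energyFluctuationExtensive_holds`: `Var_T(H_N) ≤ C_V·N`).**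
1. `vanishingSurvival_of_boundaryDEP : BoundaryDEP → VanishingSurvival` — GLE crux 13200 follows from GLE crux 13198
   (`N·S_N(A·N²) ≤ C_V/(2γT²A)`); so `transmissionLaw_of_boundaryDEP : BoundaryDEP → FiniteHorizonTransmission →
   PositiveTransmission → TransmissionLaw` (the GLE assembly with `VanishingSurvival` discharged).
2. `storageBound_of_boundaryDEP : BoundaryDEP → StorageBound` — the storage leg (D_S) of door v6 needs no corrector grade.
3. `transientCeilingPoint_of_boundaryDEP : BoundaryDEP → TransientCeilingPoint` — (U) from the sign alone.
4. DOOR v7 `boundedResponse_of_leakPoint_boundaryDEP : LeakPoint → BoundaryDEP → BoundedResponse` and its converse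
   `leakPoint_of_boundedResponse_boundaryDEP`; `leakPoint_iff_boundedResponse_of_boundaryDEP`.
5. The **limit-exchange inequality** `escapeDeficit_le_transmission_add_variance`:
   `E_N ≤ X_N(t) + Var_T(H_N)/(2γT²·t)` for every `t > 0` (`X_N(t) = (γ/T²)∫_{(0,t]} K̃_N` the finite-horizon transmission), whence
   the **Thouless-horizon reading as a theorem**: `finiteHorizonBound_iff_boundedResponse_of_boundaryDEP :
   BoundaryDEP → (FiniteHorizonBound ↔ BoundedResponse)` (`FiniteHorizonBound`: `∃ A > 0, N·X_N(A·N²) = O(1)`), and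
   `boundedResponse_of_finiteHorizonTransmission_boundaryDEP : FiniteHorizonTransmission → BoundaryDEP → BoundedResponse`
   (11071 ⟸ GLE cruxes 13199 ∧ 13198).

Tags: `[new]` = stated and proved here for the first time in the tree; `[folklore]` = standard bookkeeping.  0 sorry.
-/

/-! # NODE g96 «SurvivalSumRule» — landing part A of 3 (lens-1 g96; bodies byte-identical to node/BondHeatUncertaintyBoundedResponseSurvivalSumRule.lean sha256 57583f39…; see that file's module docstring for the mathematics). -/

noncomputable section

open MeasureTheory ProbabilityTheory Filter Topology Set Function
open scoped NNReal ENNReal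
open Literature.MathematicalPhysics.KineticTheory.HeatConduction
open Literature.MathematicalPhysics.KineticTheory OscillatorChain
open Summit.AtomisticToContinuum.FouriersLaw.Theorems.SubdiffusiveBondHeat
open Summit.AtomisticToContinuum.FouriersLaw.Theorems.OddSectorIrreversibility
open Summit.AtomisticToContinuum.FouriersLaw.Theorems.BoundedResponse.TransientBand

namespace Summit.AtomisticToContinuum.FouriersLaw.Theorems.BoundedResponse.ParityFloor

open Summit.AtomisticToContinuum.FouriersLaw.Theses.BondHeatUncertainty (BoundedResponse)
open Summit.AtomisticToContinuum.FouriersLaw.Theses.GriffithsLimitExchange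
  (BoundaryDEP KernelIntegrable FiniteHorizonTransmission PositiveTransmission VanishingSurvival TransmissionLaw)
open Summit.AtomisticToContinuum.FouriersLaw.Theorems.SubdiffusiveBondHeat.EscapeGrading
  (escapeDeficit OhmicFloor ohmicFloor_iff_boundedResponse)

section SurvivalSumRule

variable {ω₂ lam β γ T : ℝ}

section Pinned

variable {N : ℕ}

/-! ## §1 The survival function, the kernels and the exit identity -/

/-- **The two-exit survival function** `S_N(t) := (γ/T²) ∫_{(t,∞)} (K_N(u) + K̃_N(u)) du` — literally the `S` of
`GriffithsLimitExchange.VanishingSurvival` (`K_N = escapeKernel`, `K̃_N = crossKernel`). [new] -/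
def survival (ω₂ lam β γ T : ℝ) (N : ℕ) (t : ℝ) : ℝ :=
  γ / T ^ 2 * ∫ u in Ioi t, (escapeKernel ω₂ lam β γ T N u + crossKernel ω₂ lam β γ T N u)

/-- **The storage kernel** `g_N(s) := ⟨θ₀, P_s(H − ⟨H⟩)⟩_{μ_T}` (`0` at `N = 0`) — the integrand of
`storageResponse_eq_intervalIntegral` (`S^{stor}_N(t) = T⁻² ∫₀ᵗ g_N`). [new] -/
def storageKernel (ω₂ lam β γ T : ℝ) (N : ℕ) (s : ℝ) : ℝ :=
  if h : 0 < N then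
    ∫ z, kinObs T N ⟨0, h⟩ z *
        (∫ y, ((pinnedChain ω₂ lam β γ).hamiltonian N y -
            ∫ x, (pinnedChain ω₂ lam β γ).hamiltonian N x ∂((pinnedChain ω₂ lam β γ).gibbsMeasure N T))
          ∂((pinnedChain ω₂ lam β γ).transitionKernel N T T s.toNNReal z))
      ∂((pinnedChain ω₂ lam β γ).gibbsMeasure N T)
  else 0

/-- **The canonical energy variance** `Var_T(H_N) = ∫ (H − ⟨H⟩)² dμ_T` (the quantity of `EnergyFluctuationExtensive`). [new] -/
def energyVariance (ω₂ lam β γ T : ℝ) (N : ℕ) : ℝ :=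
  ∫ z, ((pinnedChain ω₂ lam β γ).hamiltonian N z -
      ∫ x, (pinnedChain ω₂ lam β γ).hamiltonian N x ∂((pinnedChain ω₂ lam β γ).gibbsMeasure N T)) ^ 2
    ∂((pinnedChain ω₂ lam β γ).gibbsMeasure N T)

/-- **The energy–corrector pairing** `Λ_N := ⟨H − ⟨H⟩, h₀⟩_{μ_T}` (`0` at `N = 0`). [new] -/
def energyPairing (ω₂ lam β γ T : ℝ) (N : ℕ) : ℝ :=
  if h : 0 < N then
    ∫ z, ((pinnedChain ω₂ lam β γ).hamiltonian N z -
        ∫ x, (pinnedChain ω₂ lam β γ).hamiltonian N x ∂((pinnedChain ω₂ lam β γ).gibbsMeasure N T)) *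
      kinCorrector ω₂ lam β γ T N ⟨0, h⟩ z ∂((pinnedChain ω₂ lam β γ).gibbsMeasure N T)
  else 0

/-- `K̃_N(u) = ⟨θ₀, P_u θ_{N−1}⟩` for `N ≥ 1`. [formal bookkeeping] -/
theorem crossKernel_of_pos (hN : 0 < N) (u : ℝ) :
    crossKernel ω₂ lam β γ T N u =
      ∫ z, kinObs T N ⟨0, hN⟩ z * kinAct ω₂ lam β γ T N ⟨N - 1, by omega⟩ u z
        ∂((pinnedChain ω₂ lam β γ).gibbsMeasure N T) := by
  rw [crossKernel, dif_pos hN]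

/-- `K_N(u) = ⟨θ₀, P_u θ₀⟩` for `N ≥ 1`, in the `kinObs`/`kinAct` vocabulary. [formal bookkeeping] -/
theorem escapeKernel_eq_kinAct (hN : 0 < N) (u : ℝ) :
    escapeKernel ω₂ lam β γ T N u =
      ∫ z, kinObs T N ⟨0, hN⟩ z * kinAct ω₂ lam β γ T N ⟨0, hN⟩ u z
        ∂((pinnedChain ω₂ lam β γ).gibbsMeasure N T) := by
  rw [escapeKernel_of_pos hN]
  rfl

/-- `Λ_N = ⟨H − ⟨H⟩, h₀⟩` for `N ≥ 1`. [formal bookkeeping] -/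
theorem energyPairing_of_pos (hN : 0 < N) :
    energyPairing ω₂ lam β γ T N =
      ∫ z, ((pinnedChain ω₂ lam β γ).hamiltonian N z -
          ∫ x, (pinnedChain ω₂ lam β γ).hamiltonian N x ∂((pinnedChain ω₂ lam β γ).gibbsMeasure N T)) *
        kinCorrector ω₂ lam β γ T N ⟨0, hN⟩ z ∂((pinnedChain ω₂ lam β γ).gibbsMeasure N T) := by
  rw [energyPairing, dif_pos hN]

/-- `K̃_N ∈ L¹(0,∞)` (the GLE support item `KernelIntegrable`, in the `crossKernel` name; trivial at `N = 0`). [folklore] -/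
theorem integrableOn_crossKernel (hω : 0 < ω₂) (hl : 0 < lam) (hβ : 0 < β) (hγ : 0 < γ) (hT : 0 < T) (N : ℕ) :
    IntegrableOn (crossKernel ω₂ lam β γ T N) (Ioi 0) := by
  rcases Nat.eq_zero_or_pos N with rfl | hN
  · have h0 : crossKernel ω₂ lam β γ T 0 = fun _ => 0 := by
      funext u
      rw [crossKernel, dif_neg (lt_irrefl 0)]
    rw [h0]
    exact integrableOn_zero
  · refine (GriffithsLimitExchange.pinnedChain_kinCrossCorr_integrableOn hω hl.le hβ hγ hN hT ⟨0, hN⟩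
      ⟨N - 1, by omega⟩).congr_fun (fun u _ => ?_) measurableSet_Ioi
    rw [crossKernel_of_pos hN]
    rfl

/-- **Fubini at the hot contact over `(0,∞)`**: `⟨θ₀, h_b⟩_{μ_T} = ∫_{(0,∞)} ⟨θ₀, P_u θ_b⟩_{μ_T} du`. [folklore] -/
theorem integral_kinObs_mul_kinCorrector_eq (hω : 0 < ω₂) (hl : 0 < lam) (hβ : 0 < β) (hγ : 0 < γ) (hN : 0 < N)
    (hT : 0 < T) (b : Fin N) :
    ∫ z, kinObs T N ⟨0, hN⟩ z * kinCorrector ω₂ lam β γ T N b z ∂((pinnedChain ω₂ lam β γ).gibbsMeasure N T) =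
      ∫ u in Ioi 0, ∫ z, kinObs T N ⟨0, hN⟩ z * kinAct ω₂ lam β γ T N b u z
        ∂((pinnedChain ω₂ lam β γ).gibbsMeasure N T) := by
  set P := pinnedChain ω₂ lam β γ with hP
  haveI : IsProbabilityMeasure (P.gibbsMeasure N T) :=
    pinnedChain_isProbabilityMeasure_gibbsMeasure hω hl.le hβ.le γ N hT
  obtain ⟨hϑ0, h2ϑ, hϑ1⟩ := weight_facts hT
  obtain ⟨K, c, hK, hc, hb⟩ := harrisBound_exists hω hl.le hβ hγ hN hT hϑ0 hϑ1
  obtain ⟨hθm, hθ2⟩ := kinObs_sq_facts hω hl.le hβ hγ hN hT ⟨0, hN⟩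
  have hν : Integrable (fun y => Real.exp (2 * (1 / (4 * T)) * P.hamiltonian N y)) (P.gibbsMeasure N T) :=
    pinnedChain_integrable_exp_mul_hamiltonian_gibbsMeasure hω hl.le hβ.le γ N hT h2ϑ
  exact integral_mul_setIntegral_kinAct hω hl.le hβ.le hγ.le hT hϑ0 hK.le hb hc b (P.gibbsMeasure N T) hν hθm hθ2
    (S := Ioi 0) (fun u hu => hu)

/-- `⟨θ₀, h₀⟩_{μ_T} = ∫_{(0,∞)} K_N`. [folklore] -/
theorem integral_kinObs_mul_kinCorrector_zero_eq (hω : 0 < ω₂) (hl : 0 < lam) (hβ : 0 < β) (hγ : 0 < γ) (hN : 0 < N)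
    (hT : 0 < T) :
    ∫ z, kinObs T N ⟨0, hN⟩ z * kinCorrector ω₂ lam β γ T N ⟨0, hN⟩ z ∂((pinnedChain ω₂ lam β γ).gibbsMeasure N T) =
      ∫ u in Ioi 0, escapeKernel ω₂ lam β γ T N u := by
  rw [integral_kinObs_mul_kinCorrector_eq hω hl hβ hγ hN hT ⟨0, hN⟩]
  exact setIntegral_congr_fun measurableSet_Ioi fun u _ => (escapeKernel_eq_kinAct hN u).symm

/-- `⟨θ₀, h_{N−1}⟩_{μ_T} = ∫_{(0,∞)} K̃_N`. [folklore] -/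
theorem integral_kinObs_mul_kinCorrector_last_eq (hω : 0 < ω₂) (hl : 0 < lam) (hβ : 0 < β) (hγ : 0 < γ) (hN : 0 < N)
    (hT : 0 < T) :
    ∫ z, kinObs T N ⟨0, hN⟩ z * kinCorrector ω₂ lam β γ T N ⟨N - 1, by omega⟩ z
        ∂((pinnedChain ω₂ lam β γ).gibbsMeasure N T) =
      ∫ u in Ioi 0, crossKernel ω₂ lam β γ T N u := by
  rw [integral_kinObs_mul_kinCorrector_eq hω hl hβ hγ hN hT ⟨N - 1, by omega⟩]
  exact setIntegral_congr_fun measurableSet_Ioi fun u _ => (crossKernel_of_pos hN u).symm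

/-- **Exit identity**: `E_N = (γ/T²) ∫_{(0,∞)} K̃_N` — the escape deficit IS the total end-to-end transmission; equivalently
`(γ/T²)(∫_{(0,∞)} K_N + ∫_{(0,∞)} K̃_N) = 1` (`escapeDeficit_eq`).  (`N ≥ 2`.) [new] -/
theorem escapeDeficit_eq_integral_crossKernel (hω : 0 < ω₂) (hl : 0 < lam) (hβ : 0 < β) (hγ : 0 < γ) (hN : 2 ≤ N)
    (hT : 0 < T) :
    escapeDeficit ω₂ lam β γ T N = γ / T ^ 2 * ∫ u in Ioi 0, crossKernel ω₂ lam β γ T N u := by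
  rw [escapeDeficit_eq_crossPairing hω hl hβ hγ hN hT, integral_kinObs_mul_kinCorrector_last_eq hω hl hβ hγ (by omega) hT]

/-- **`S_N = 1 − θ_N − φ_N`**: for `N ≥ 2` and `s ≥ 0`,
`S_N(s) = 1 − θ_N(s) − (γ/T²)∫₀ˢ K̃_N` (exit identity + splitting `(0,∞) = (0,s] ∪ (s,∞)`). [new] -/
theorem survival_eq (hω : 0 < ω₂) (hl : 0 < lam) (hβ : 0 < β) (hγ : 0 < γ) (hN : 2 ≤ N) (hT : 0 < T)
    {s : ℝ} (hs : 0 ≤ s) :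
    survival ω₂ lam β γ T N s =
      1 - stepResponse ω₂ lam β γ T N s - γ / T ^ 2 * ∫ u in (0 : ℝ)..s, crossKernel ω₂ lam β γ T N u := by
  have hKi := integrableOn_escapeKernel hω hl hβ hγ hT N
  have hKti := integrableOn_crossKernel hω hl hβ hγ hT N
  have key : γ / T ^ 2 * ∫ u in Ioi 0, crossKernel ω₂ lam β γ T N u =
      1 - γ / T ^ 2 * ∫ u in Ioi 0, escapeKernel ω₂ lam β γ T N u :=
    (escapeDeficit_eq_integral_crossKernel hω hl hβ hγ hN hT).symm.trans (escapeDeficit_eq ω₂ lam β γ T N)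
  have sK : ∫ u in Ioi 0, escapeKernel ω₂ lam β γ T N u =
      (∫ u in (0 : ℝ)..s, escapeKernel ω₂ lam β γ T N u) + ∫ u in Ioi s, escapeKernel ω₂ lam β γ T N u := by
    rw [intervalIntegral.integral_of_le hs, ← setIntegral_union Ioc_disjoint_Ioi_same measurableSet_Ioi
      (hKi.mono_set Ioc_subset_Ioi_self) (hKi.mono_set (Ioi_subset_Ioi hs)), Ioc_union_Ioi_eq_Ioi hs]
  have sKt : ∫ u in Ioi 0, crossKernel ω₂ lam β γ T N u =
      (∫ u in (0 : ℝ)..s, crossKernel ω₂ lam β γ T N u) + ∫ u in Ioi s, crossKernel ω₂ lam β γ T N u := by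
    rw [intervalIntegral.integral_of_le hs, ← setIntegral_union Ioc_disjoint_Ioi_same measurableSet_Ioi
      (hKti.mono_set Ioc_subset_Ioi_self) (hKti.mono_set (Ioi_subset_Ioi hs)), Ioc_union_Ioi_eq_Ioi hs]
  rw [survival, stepResponse, integral_add (hKi.mono_set (Ioi_subset_Ioi hs)) (hKti.mono_set (Ioi_subset_Ioi hs))]
  rw [sK, sKt] at key
  linear_combination key

/-- `S_N(t) ≥ 0` for `t ≥ 0` whenever `K_N + K̃_N ≥ 0` on `[0,∞)` (e.g. under `BoundaryDEP`). [folklore] -/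
theorem survival_nonneg (hγ : 0 ≤ γ)
    (hsum : ∀ u : ℝ, 0 ≤ u → 0 ≤ escapeKernel ω₂ lam β γ T N u + crossKernel ω₂ lam β γ T N u)
    {t : ℝ} (ht : 0 ≤ t) : 0 ≤ survival ω₂ lam β γ T N t :=
  mul_nonneg (div_nonneg hγ (sq_nonneg T))
    (setIntegral_nonneg measurableSet_Ioi fun u hu => hsum u (ht.trans (le_of_lt hu)))

/-- `S_N` is non-increasing on `[0,∞)` whenever `K_N + K̃_N ≥ 0` there. [folklore] -/
theorem survival_antitoneOn (hω : 0 < ω₂) (hl : 0 < lam) (hβ : 0 < β) (hγ : 0 < γ) (hT : 0 < T)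
    (hsum : ∀ u : ℝ, 0 ≤ u → 0 ≤ escapeKernel ω₂ lam β γ T N u + crossKernel ω₂ lam β γ T N u) :
    AntitoneOn (survival ω₂ lam β γ T N) (Ici 0) := by
  intro s hs t ht hst
  have hs0 : (0 : ℝ) ≤ s := hs
  have hi : IntegrableOn (fun u => escapeKernel ω₂ lam β γ T N u + crossKernel ω₂ lam β γ T N u) (Ioi 0) :=
    (integrableOn_escapeKernel hω hl hβ hγ hT N).add (integrableOn_crossKernel hω hl hβ hγ hT N)
  unfold survival
  refine mul_le_mul_of_nonneg_left ?_ (div_nonneg hγ.le (sq_nonneg T))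
  rw [← Ioc_union_Ioi_eq_Ioi hst, setIntegral_union Ioc_disjoint_Ioi_same measurableSet_Ioi
    (hi.mono_set (Ioc_subset_Ioi_self.trans (Ioi_subset_Ioi hs0))) (hi.mono_set (Ioi_subset_Ioi (hs0.trans hst)))]
  exact le_add_of_nonneg_left (setIntegral_nonneg measurableSet_Ioc fun u hu => hsum u (hs0.trans hu.1.le))

/-! ## §2 The first law in survival form: `S^{stor}_N(t) = ∫₀ᵗ S_N` -/

/-- **First law, survival form.** For `N ≥ 2` and `t ≥ 0`: `S^{stor}_N(t) = ∫₀ᵗ S_N(s) ds` — the heat stored in the chain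
is the time-integral of the two-exit survival.  Proof: `S^{stor} = W − F` (tree `deficitCesaro_eq_storage_add_leak`),
`W_N(t) = ∫₀ᵗ (1 − θ_N)`, `F_N(t) = (γ/T²)∫₀ᵗ∫₀ˢ K̃_N` (tree `leakResponse_eq_intervalIntegral` +
`integral_kinObs_mul_corrAct_eq`) and `survival_eq`. [new] -/
theorem storageResponse_eq_integral_survival (hω : 0 < ω₂) (hl : 0 < lam) (hβ : 0 < β) (hγ : 0 < γ) (hN : 2 ≤ N)
    (hT : 0 < T) {t : ℝ} (ht : 0 ≤ t) :
    storageResponse ω₂ lam β γ T N t = ∫ s in (0 : ℝ)..t, survival ω₂ lam β γ T N s := by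
  have hN0 : 0 < N := by omega
  have hKti := integrableOn_crossKernel hω hl hβ hγ hT N
  have hWSF := deficitCesaro_eq_storage_add_leak hω hl hβ hγ hN hT ht
  have hF := leakResponse_eq_intervalIntegral hω hl hβ hγ hN hT ht
  have hθi : IntervalIntegrable (fun s => 1 - stepResponse ω₂ lam β γ T N s) volume 0 t :=
    intervalIntegrable_const.sub ((continuous_stepResponse hω hl hβ hγ hT N).intervalIntegrable 0 t)
  have hφc : ContinuousOn (fun s => ∫ u in (0 : ℝ)..s, crossKernel ω₂ lam β γ T N u) (uIcc 0 t) :=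
    intervalIntegral.continuousOn_primitive_interval'
      ((intervalIntegrable_iff_integrableOn_Ioc_of_le ht).2 (hKti.mono_set Ioc_subset_Ioi_self)) left_mem_uIcc
  have hφi : IntervalIntegrable (fun s => γ / T ^ 2 * ∫ u in (0 : ℝ)..s, crossKernel ω₂ lam β γ T N u) volume 0 t :=
    hφc.intervalIntegrable.const_mul _
  have e1 : ∫ s in (0 : ℝ)..t, survival ω₂ lam β γ T N s =
      ∫ s in (0 : ℝ)..t, ((1 - stepResponse ω₂ lam β γ T N s) -
        γ / T ^ 2 * ∫ u in (0 : ℝ)..s, crossKernel ω₂ lam β γ T N u) :=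
    intervalIntegral.integral_congr fun s hs => by
      rw [uIcc_of_le ht] at hs
      exact survival_eq hω hl hβ hγ hN hT hs.1
  have e2 : ∫ s in (0 : ℝ)..t, ∫ z, kinObs T N ⟨0, hN0⟩ z * corrAct ω₂ lam β γ T N ⟨N - 1, by omega⟩ s z
        ∂((pinnedChain ω₂ lam β γ).gibbsMeasure N T) =
      ∫ s in (0 : ℝ)..t, ((∫ z, kinObs T N ⟨0, hN0⟩ z * kinCorrector ω₂ lam β γ T N ⟨N - 1, by omega⟩ z
          ∂((pinnedChain ω₂ lam β γ).gibbsMeasure N T)) - ∫ u in (0 : ℝ)..s, crossKernel ω₂ lam β γ T N u) :=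
    intervalIntegral.integral_congr fun s hs => by
      rw [uIcc_of_le ht] at hs
      exact integral_kinObs_mul_corrAct_eq hω hl hβ hγ hN0 hT hs.1
  rw [e1, intervalIntegral.integral_sub hθi hφi, eq_sub_of_add_eq hWSF.symm, deficitCesaro, hF, e2,
    intervalIntegral.integral_sub intervalIntegrable_const hφc.intervalIntegrable,
    intervalIntegral.integral_const_mul]
  ring

/-- `S^{stor}_N ≥ 0` on `[0,∞)` whenever `K_N + K̃_N ≥ 0` there (`N ≥ 2`). [folklore] -/
theorem storageResponse_nonneg (hω : 0 < ω₂) (hl : 0 < lam) (hβ : 0 < β) (hγ : 0 < γ) (hN : 2 ≤ N) (hT : 0 < T)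
    (hsum : ∀ u : ℝ, 0 ≤ u → 0 ≤ escapeKernel ω₂ lam β γ T N u + crossKernel ω₂ lam β γ T N u)
    {t : ℝ} (ht : 0 ≤ t) : 0 ≤ storageResponse ω₂ lam β γ T N t := by
  rw [storageResponse_eq_integral_survival hω hl hβ hγ hN hT ht]
  exact intervalIntegral.integral_nonneg ht fun s hs => survival_nonneg hγ.le hsum hs.1

/-- `S^{stor}_N` is non-decreasing on `[0,∞)` whenever `K_N + K̃_N ≥ 0` there (`N ≥ 2`). [folklore] -/
theorem storageResponse_mono (hω : 0 < ω₂) (hl : 0 < lam) (hβ : 0 < β) (hγ : 0 < γ) (hN : 2 ≤ N) (hT : 0 < T)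
    (hsum : ∀ u : ℝ, 0 ≤ u → 0 ≤ escapeKernel ω₂ lam β γ T N u + crossKernel ω₂ lam β γ T N u)
    {t t' : ℝ} (ht : 0 ≤ t) (htt' : t ≤ t') :
    storageResponse ω₂ lam β γ T N t ≤ storageResponse ω₂ lam β γ T N t' := by
  have hanti := survival_antitoneOn hω hl hβ hγ hT hsum
  have h01 : IntervalIntegrable (survival ω₂ lam β γ T N) volume 0 t :=
    (hanti.mono (by rw [uIcc_of_le ht]; exact Icc_subset_Ici_self)).intervalIntegrable
  have h12 : IntervalIntegrable (survival ω₂ lam β γ T N) volume t t' :=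
    (hanti.mono (by rw [uIcc_of_le htt']; exact (Icc_subset_Ici_self).trans (Ici_subset_Ici.2 ht))).intervalIntegrable
  rw [storageResponse_eq_integral_survival hω hl hβ hγ hN hT ht,
    storageResponse_eq_integral_survival hω hl hβ hγ hN hT (ht.trans htt'),
    ← intervalIntegral.integral_add_adjacent_intervals h01 h12]
  exact le_add_of_nonneg_right
    (intervalIntegral.integral_nonneg htt' fun s hs => survival_nonneg hγ.le hsum (ht.trans hs.1))

/-- `t·S_N(t) ≤ S^{stor}_N(t)` for `t ≥ 0` (`S_N` is non-increasing; `N ≥ 2`, `K_N + K̃_N ≥ 0`). [new] -/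
theorem mul_survival_le_storageResponse (hω : 0 < ω₂) (hl : 0 < lam) (hβ : 0 < β) (hγ : 0 < γ) (hN : 2 ≤ N)
    (hT : 0 < T) (hsum : ∀ u : ℝ, 0 ≤ u → 0 ≤ escapeKernel ω₂ lam β γ T N u + crossKernel ω₂ lam β γ T N u)
    {t : ℝ} (ht : 0 ≤ t) :
    t * survival ω₂ lam β γ T N t ≤ storageResponse ω₂ lam β γ T N t := by
  have hanti := survival_antitoneOn hω hl hβ hγ hT hsum
  have h01 : IntervalIntegrable (survival ω₂ lam β γ T N) volume 0 t :=
    (hanti.mono (by rw [uIcc_of_le ht]; exact Icc_subset_Ici_self)).intervalIntegrable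
  rw [storageResponse_eq_integral_survival hω hl hβ hγ hN hT ht]
  calc t * survival ω₂ lam β γ T N t = ∫ _s in (0 : ℝ)..t, survival ω₂ lam β γ T N t := by
        rw [intervalIntegral.integral_const, smul_eq_mul, sub_zero]
    _ ≤ ∫ s in (0 : ℝ)..t, survival ω₂ lam β γ T N s :=
        intervalIntegral.integral_mono_on ht intervalIntegrable_const h01 fun s hs =>
          hanti (show (0 : ℝ) ≤ s from hs.1) (show (0 : ℝ) ≤ t from ht) hs.2


end Pinned

end SurvivalSumRule

end Summit.AtomisticToContinuum.FouriersLaw.Theorems.BoundedResponse.ParityFloor
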